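import Summits.BirchSwinnertonDyer.BirchSwinnertonDyer.Theorems.KimAtThreeKolyvaginDeepLowerOfCertificate
import HarnessLib

/-!
# Route `KimAtThreeKolyvagin` (rung W2): the JOINT finite falsifier of the cruxes `DeepLowerAtThree`
# (item 19075) and `ShallowEqDeepAtTorsionFree` (item 19077) — a shallow UNIT Kurihara number on a row
# with `ord₃ #Ш(E/ℚ)(3) < ∂⁽⁰⁾(δ̃)`

Cell `bsd-addord`, seat `bsd-addord-w2-c2` (D-0074 row B5, gen 2), item `stmt-BirchSwinnertonDyer-19075`.
Crux 19075 ALONE is a statement about the DEEP LIMIT `∂^{(∞)}_{deep}(δ̃) = inf_i sup_k ∂^{(i)}(δ̃^{(k)})`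
and is not decided by any finite set of Kurihara numbers (every finite family of levels is compatible
with any value of the deep limit). But together with crux 19077 (`∂^{(∞)}_{deep} ≤ ∂^{(∞)}`, the
all-levels infimum) it has a FINITE test, recorded here as kernel theorems (pure bookkeeping on the
tree's `KuriharaNumberInvariants` / `KuriharaNumberDeepInvariants`; no fact, nothing asserted):

* `not_deepLower_and_shallowEqDeep_conclusions_of_unit_of_lt` (general `p`, one row): if some cyclic
  Kolyvagin level `n ∈ 𝒩₁(E,p)` — however shallow — carries a UNIT Kurihara number
  (`kuriharaNumber f p n ψ ≠ 0`), then `∂^{(∞)}(δ̃) = 0`; if moreover `s < ∂⁽⁰⁾(δ̃)`, then the conclusions of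
  19075 (`∂⁽⁰⁾ ≤ s + ∂^{(∞)}_{deep}`) and 19077 (`∂^{(∞)}_{deep} ≤ ∂^{(∞)}`) cannot BOTH hold at the row.
* `deepLowerAtThree_and_shallowEqDeep_false_of_witness` (crux level, `p = 3`): ONE witness row —
  `W/ℚ` globally minimal, `3`-adic tower onto, `E(ℚ₃)[3] = 0`, `Ш` finite, newform `f` with `3`-integral
  plus symbols, `ord(δ̃) = 0`, `ord₃ #Ш(E/ℚ)(3) < ∂⁽⁰⁾(δ̃)` (e.g. `Sel₃(E) = 0` by `3`-descent and
  `3 ∣ [0]⁺_f`), and a unit `δ̃_n` at a cyclic level — REFUTES `DeepLowerAtThree ∧ ShallowEqDeepAtTorsionFree`.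
  This is the kernel form of the cell's P1/P2 kit tests (memo kim3 §18: 12 + 30 curves with
  `3 ∣ ∏ c_ℓ`, all cyclic-level `δ̃_n ≡ 0 (mod 3)` — no witness found), and of Kim 2025 §8.1.2 ("due to
  the non-trivial Tamagawa defect, `δ̃_n` vanishes mod `3` for every `n ∈ 𝒩₁`", conductor `20787`).
* `deepLower_conclusion_false_of_deepUnits_of_lt` (general `p`): the INFINITE falsifier of 19075 alone —
  unit Kurihara numbers of one fixed `ν = i` at ARBITRARILY DEEP cyclic levels force `∂^{(∞)}_{deep} = 0`,
  incompatible with `s < ∂⁽⁰⁾` (not finitely checkable; recorded for the disprover's vocabulary).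

References: [Kim2022StructureSelmer] §1.5.1 (PDF p. 7), Conj. 1.10; [Kim2025RefinedTNC] Thm. 1.1, §8.1.2;
[MazurRubin2004] Def. 4.5.7, Def. 5.2.11.
-/

set_option autoImplicit false
-- the Theorems namespace of a single-conjunct summit repeats the summit name by design (D-0017)
set_option linter.dupNamespace false

noncomputable section

open scoped MatrixGroups ModularForm Classical

open CongruenceSubgroup WeierstrassCurve Literature.NumberTheory.EllipticCurves
  Literature.NumberTheory.EllipticCurves.ModularForms

namespace Summit.BirchSwinnertonDyer.BirchSwinnertonDyer.Theorems.KimAtThreeDeepLowerShallowUnitTest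

open Summit.BirchSwinnertonDyer.BirchSwinnertonDyer.Theses.KimAtThreeKolyvagin
open Summit.BirchSwinnertonDyer.BirchSwinnertonDyer.Theorems.KimAtThreeKolyvaginUnitLevelOneRungs
open Summit.BirchSwinnertonDyer.BirchSwinnertonDyer.Theorems.KimAtThreeKolyvaginCertificateDictionary

/-! ### §1 One row, general `p` -/

section Row

variable (W : WeierstrassCurve ℚ) [W.IsGloballyMinimal] (p : ℕ) {N : ℕ} (f : CuspForm (Gamma0 N) 2)

/-- **A shallow unit and a defect kill the conjunction of the two cruxes' conclusions.** If a cyclic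
level `n ∈ 𝒩₁(E,p)` carries a unit Kurihara number then `∂^{(∞)}(δ̃) = 0`
(`kuriharaPartialInfty_eq_zero_of_ne_zero`); with `∂^{(∞)}_{deep} ≤ ∂^{(∞)}` (19077 at the row) the deep
limit is `0`, and then `∂⁽⁰⁾ ≤ s + 0` (19075 at the row) contradicts `s < ∂⁽⁰⁾`.
[cite: Kim2022StructureSelmer, §1.5.1 (PDF p. 7)] [cite: MazurRubin2004, Def. 5.2.11] -/
theorem not_deepLower_and_shallowEqDeep_conclusions_of_unit_of_lt {n : ℕ} [NeZero n]
    (hn : IsCyclicKolyvaginLevel W p n)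
    (ψ : (ℓ : ℕ) → (ZMod ℓ)ˣ →* Multiplicative (ZMod (p ^ 1)))
    (hψ : ∀ ℓ ∈ n.primeFactors, Function.Surjective (ψ ℓ))
    (hunit : kuriharaNumber f (p ^ 1) n ψ ≠ 0) {s : ℕ}
    (hlt : (s : ℕ∞) < kuriharaPartial W p f 0) :
    ¬ ((∃ d : ℕ, kuriharaPartialDeepInfty W p f = d ∧
          kuriharaPartial W p f 0 ≤ ((s + d : ℕ) : ℕ∞)) ∧
        kuriharaPartialDeepInfty W p f ≤ kuriharaPartialInfty W p f) := by
  rintro ⟨⟨d, hd, hle⟩, hshallow⟩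
  have h0 : kuriharaPartialInfty W p f = 0 := kuriharaPartialInfty_eq_zero_of_ne_zero W p f hn ψ hψ hunit
  rw [h0, hd] at hshallow
  have hd0 : d = 0 := by exact_mod_cast nonpos_iff_eq_zero.mp hshallow
  subst hd0
  rw [add_zero] at hle
  exact (lt_irrefl _) (hlt.trans_le hle)

/-- **The infinite falsifier of 19075 alone.** Unit Kurihara numbers of a fixed `ν = i` at cyclic
levels of EVERY depth `k` (`n_k ∈ 𝒩_k(E,p)`) force `∂^{(i)}(δ̃^{(k)}) = 0` for all `k`, hence
`∂^{(∞)}_{deep}(δ̃) = 0`, incompatible with 19075's conclusion when `s < ∂⁽⁰⁾(δ̃)`.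
[cite: MazurRubin2004, Def. 4.5.7, Def. 5.2.11] [cite: Kim2022StructureSelmer, §1.5.1 (PDF p. 7)] -/
theorem deepLower_conclusion_false_of_deepUnits_of_lt (i : ℕ)
    (hunits : ∀ k : ℕ, ∃ (n : ℕ) (_ : NeZero n) (ψ : (ℓ : ℕ) → (ZMod ℓ)ˣ →* Multiplicative (ZMod (p ^ 1))),
      IsCyclicKolyvaginLevel W p n ∧ Kato.IsKolyvaginProduct W p k n ∧ n.primeFactors.card = i ∧
      (∀ ℓ ∈ n.primeFactors, Function.Surjective (ψ ℓ)) ∧ kuriharaNumber f (p ^ 1) n ψ ≠ 0)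
    {s : ℕ} (hlt : (s : ℕ∞) < kuriharaPartial W p f 0) :
    ¬ (∃ d : ℕ, kuriharaPartialDeepInfty W p f = d ∧
        kuriharaPartial W p f 0 ≤ ((s + d : ℕ) : ℕ∞)) := by
  rintro ⟨d, hd, hle⟩
  -- every `∂^{(i)}(δ̃^{(k)})` vanishes, so `∂^{(i)}_{deep} = 0` and the deep limit is `0`
  have hdeep : kuriharaPartialDeep W p f i = 0 := by
    refine le_antisymm (iSup_le fun k => ?_) zero_le
    obtain ⟨n, _, ψ, hn, hk, hi, hψ, hunit⟩ := hunits k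
    exact (kuriharaPartialDeepAt_eq_zero_of_ne_zero W p f hn hk hi ψ hψ hunit).le
  have hinf : kuriharaPartialDeepInfty W p f = 0 :=
    le_antisymm ((kuriharaPartialDeepInfty_le W p f i).trans hdeep.le) zero_le
  rw [hinf] at hd
  have hd0 : d = 0 := by exact_mod_cast hd.symm
  subst hd0
  rw [add_zero] at hle
  exact (lt_irrefl _) (hlt.trans_le hle)

end Row

/-! ### §2 Crux level, `p = 3`: one witness row refutes `DeepLowerAtThree ∧ ShallowEqDeepAtTorsionFree` -/

/-- **The joint finite falsifier of the W2 route's cruxes 19075 ∧ 19077.** A witness row — `W/ℚ`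
globally minimal with the `3`-adic tower onto, `E(ℚ₃)[3] = 0`, `Ш(E/ℚ)` finite, `f` the newform with
`3`-integral plus symbols, `ord(δ̃) = 0`, DEFECT `ord₃ #Ш(E/ℚ)(3) < ∂⁽⁰⁾(δ̃)`, and a UNIT Kurihara number at
some cyclic level `n ∈ 𝒩₁(E,3)` — refutes the conjunction `DeepLowerAtThree ∧ ShallowEqDeepAtTorsionFree`.
(By Kim's theory no such row exists: a positive defect is a positive Tamagawa exponent, which kills every
shallow unit; the cell's kit tests P1/P2 and Kim 2025 §8.1.2 agree.) [cite: Kim2025RefinedTNC, Thm. 1.1 and §8.1.2]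
[cite: Kim2022StructureSelmer, §1.5.1 (PDF p. 7), Conj. 1.10 (PDF p. 8)] -/
theorem deepLowerAtThree_and_shallowEqDeep_false_of_witness
    (W : WeierstrassCurve ℚ) [W.IsElliptic] [W.IsGloballyMinimal]
    (htower : ∀ m : ℕ, W.HasSurjectiveModNGaloisRep (3 ^ m : ℕ))
    (ht0 : Nat.card {Q : (W.baseChange ℚ_[3]).toAffine.Point // (3 : ℕ) • Q = 0} = 1)
    (hfin : Finite W.sha) {N : ℕ} [NeZero N] (f : CuspForm (Gamma0 N) 2) (hf : IsNewformOf W f)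
    (hint : ∀ r : ℚ, ratPlusSymbol f r ≠ 0 → 0 ≤ padicValRat 3 (ratPlusSymbol f r))
    (hord : kuriharaVanishingOrder W 3 f = 0)
    (hdefect : ((padicValNat 3 (Nat.card (AddCommGroup.primaryComponent W.sha 3)) : ℕ) : ℕ∞) <
      kuriharaPartial W 3 f 0)
    {n : ℕ} [NeZero n] (hn : IsCyclicKolyvaginLevel W 3 n)
    (ψ : (ℓ : ℕ) → (ZMod ℓ)ˣ →* Multiplicative (ZMod (3 ^ 1)))
    (hψ : ∀ ℓ ∈ n.primeFactors, Function.Surjective (ψ ℓ))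
    (hunit : kuriharaNumber f (3 ^ 1) n ψ ≠ 0) :
    ¬ (DeepLowerAtThree ∧ ShallowEqDeepAtTorsionFree) := by
  rintro ⟨hL, hS⟩
  exact not_deepLower_and_shallowEqDeep_conclusions_of_unit_of_lt W 3 f hn ψ hψ hunit hdefect
    ⟨hL W htower hfin f hf hint hord, hS W htower ht0 hfin f hf hint hord⟩

/-- **The same witness in BSD-style currency for the defect**: `Ш(E/ℚ)(3) = 0` (e.g. `Sel₃(E) = 0` by
`3`-descent) and `1 ≤ ∂⁽⁰⁾(δ̃)` (`3 ∣ [0]⁺_f`) give the defect `0 < ∂⁽⁰⁾`. [cite: Kim2025RefinedTNC, Thm. 1.1 and §8.1.2] -/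
theorem deepLowerAtThree_and_shallowEqDeep_false_of_shaTrivial_witness
    (W : WeierstrassCurve ℚ) [W.IsElliptic] [W.IsGloballyMinimal]
    (htower : ∀ m : ℕ, W.HasSurjectiveModNGaloisRep (3 ^ m : ℕ))
    (ht0 : Nat.card {Q : (W.baseChange ℚ_[3]).toAffine.Point // (3 : ℕ) • Q = 0} = 1)
    (hfin : Finite W.sha) {N : ℕ} [NeZero N] (f : CuspForm (Gamma0 N) 2) (hf : IsNewformOf W f)
    (hint : ∀ r : ℚ, ratPlusSymbol f r ≠ 0 → 0 ≤ padicValRat 3 (ratPlusSymbol f r))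
    (hord : kuriharaVanishingOrder W 3 f = 0)
    (hsha : Nat.card (AddCommGroup.primaryComponent W.sha 3) = 1)
    (hpos : (1 : ℕ∞) ≤ kuriharaPartial W 3 f 0)
    {n : ℕ} [NeZero n] (hn : IsCyclicKolyvaginLevel W 3 n)
    (ψ : (ℓ : ℕ) → (ZMod ℓ)ˣ →* Multiplicative (ZMod (3 ^ 1)))
    (hψ : ∀ ℓ ∈ n.primeFactors, Function.Surjective (ψ ℓ))
    (hunit : kuriharaNumber f (3 ^ 1) n ψ ≠ 0) :
    ¬ (DeepLowerAtThree ∧ ShallowEqDeepAtTorsionFree) := by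
  refine deepLowerAtThree_and_shallowEqDeep_false_of_witness W htower ht0 hfin f hf hint hord ?_ hn ψ hψ
    hunit
  rw [hsha, padicValNat_one_right, Nat.cast_zero]
  exact lt_of_lt_of_le zero_lt_one hpos

end Summit.BirchSwinnertonDyer.BirchSwinnertonDyer.Theorems.KimAtThreeDeepLowerShallowUnitTest

end
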